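import Summits.AnomalousDissipation.AnomalousDissipation.Theorems.SawtoothPulseCascadeK1LocalisedCascadeChirpWindowMass

/-!
# K1loc, line `Spectral` / thin start — helper: SHARP TERMWISE AMPLITUDES OF THE PHASE-ONE ITERATE («PhaseOneAmplitude», D3)

Helper file of the prover lane on the crux `K1LocalisedCascade` (stmt-AnomalousDissipation-19491), route `SawtoothPulseCascade`
(glue seat; arbiter A24-2 (2); plan `PHASE1-DIRECT-SIZING-k1locp3g4.md` §4, item D3).  The per-fibre Minkowski dischargers of the
phase-1 junk need, per source `(n, q)`, a termwise bound of `‖𝓕a₁(n,q)‖`; by `…PhaseOneModes.mFourierCoeff_phaseOne`,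
`𝓕a₁(n,q) = (I/2)(ĝ_q(n+1)ĝ_{−1}(q) − ĝ_q(n−1)ĝ₁(q))` with the phase-0 chirps `ĝ_c = 𝓕(twist ψ₀ c)`, so
`‖𝓕a₁(n,q)‖ ≤ ½(W(q) + ε)(T(q,n+1) + T(q,n−1) + 2|q|ε)` where `T(q,m)` is the SHARP one-tooth table of the exact chirp of lobe `8q`
(`½` on the lobes `m = ±8q`, `0` at the other even `m`, `16|q|/(π|64q²−m²|)` at odd `m` — `…ChirpWindowMass.norm_fourierCoeff_oneTooth_le_sharp`,
decaying like `m⁻²`, not the triangle table of `…ExactChirpSelf`), `W(q) = T(±1, q)` and `ε = 2πη` the rounding slope: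
* `phaseZero_profile_near`, `phaseOne_profile_near`, `phaseOne_rounding_le`: the cascade profiles at `γ = 8` next to the sawtooths;
* `norm_fourierCoeff_twist_le_table`: `‖ĝ_q(m)‖ ≤ T(q,m) + 2π|q|η` (`q ≠ 0`);
* `norm_mFourierCoeff_phaseOne_le_table`: the amplitude bound with `π` and `η`;
* **`norm_mFourierCoeff_phaseOne_le_rat`**: the same with `1/π ≤ 0.31831` and `2πη ≤ 2⁻²⁵` — a closed rational expression `Ā(n,q)` that
  `norm_num` evaluates in the generated per-fibre files; `phaseOne_amplitude_le_rat` is the instance for the cascade's `a 1`.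
No definitions; nothing about the crux. [cite: Grafakos2014, Prop. 3.1.2 (5), Prop. 3.2.7 (3)] [problem: turb]
-/

-- `Summit.<Summit>.<Problem>`: single-conjunct summit, the duplicate namespace segment is deliberate.
set_option linter.dupNamespace false

noncomputable section

namespace Summit.AnomalousDissipation.AnomalousDissipation.Theorems.SawtoothPulseCascade.K1Start

open MeasureTheory Filter Topology UnitAddTorus Complex AddCircle
open scoped Real
open Literature.Analysis Literature.Analysis.FunctionSpaces Literature.Analysis.FunctionSpaces.Torus Literature.Analysis.FluidPDE
open Literature.Analysis.FluidPDE.ShearStage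
open Literature.Analysis.FluidPDE.SawtoothCascade Literature.Analysis.FluidPDE.SawtoothCascade.CascadeParams
open Summit.AnomalousDissipation.AnomalousDissipation.Theorems.SawtoothPulseCascade.K1Window

/-! ## §1 The cascade profiles at `γ = 8` next to the exact sawtooths -/

section Cascade

variable (P : CascadeParams)

/-- `2(2e^{1/2} − 1) ≤ 8` (`e^{1/2} ≤ 5/3`). [folklore] -/
theorem two_mul_rounding_const_le : 2 * (2 * Real.exp (1 / 2) - 1) ≤ 8 := by
  have he : Real.exp (1 / 2) ≤ 5 / 3 := by
    have h1 : Real.exp (1 / 2) * Real.exp (1 / 2) = Real.exp 1 := by rw [← Real.exp_add]; norm_num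
    have h2 := Real.exp_one_lt_d9
    have h0 : 0 < Real.exp (1 / 2) := Real.exp_pos _
    nlinarith
  linarith

/-- **THE PHASE-1 PROFILE NEXT TO THE TWO-TOOTH SAWTOOTH**: `γ = 8`, `N₀ = 1`, `ρN = 2`, `d = 2`, `δ₀ > 0`; with
`ψ₁ = amp ⟨U 1, …⟩ γ`, for every fibre `n` and real `t`: `|n·ψ₁(t) − 8n·tri(4πt)/(4π)| ≤ |n|·(2e^{1/2}−1)δ₀/π`
(so `2π·η = 2|n|(2e^{1/2}−1)δ₀ ≤ 8|n|δ₀`). [cite: Folland1999, Prop. 2.53] -/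
theorem phaseOne_profile_near (hγ : P.γ = 8) (hN₀ : P.N₀ = 1) (hρN : P.ρN = 2) (hd : P.d = 2) (hδ₀ : 0 < P.δ₀) (n : ℤ)
    (t : ℝ) :
    |n * amp ⟨P.U 1, P.U_periodic 1, P.contDiff_U (P.δ_pos hδ₀ (by rw [hd]; norm_num) 1)⟩ P.γ t -
        ((8 * n : ℤ) : ℝ) * (tri (2 * π * (2 : ℕ) * t) / (2 * π * (2 : ℕ)))| ≤
      |(n : ℝ)| * ((2 * Real.exp (1 / 2) - 1) * P.δ₀ / π) := by
  have hπ : 0 < π := Real.pi_pos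
  have hN1 : P.N 1 = 2 := by simp [CascadeParams.N, hN₀, hρN]
  have hδ1 : P.δ 1 = P.δ₀ / 2 := by simp [CascadeParams.δ, hd]
  have hU := abs_U_sub_exactProfile_le P hδ₀ (by rw [hd]; norm_num) (j := 1) (by rw [hN1]; norm_num) t
  rw [hN1, hδ1] at hU
  rw [amp_apply, hγ]
  have e : (n : ℝ) * (8 * P.U 1 t) - ((8 * n : ℤ) : ℝ) * (tri (2 * π * (2 : ℕ) * t) / (2 * π * (2 : ℕ))) =
      8 * n * (P.U 1 t - tri (2 * π * (2 : ℕ) * t) / (2 * π * (2 : ℕ))) := by push_cast; ring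
  rw [e, abs_mul, abs_mul, abs_of_pos (by norm_num : (0:ℝ) < 8)]
  have h8 : 8 * |(n : ℝ)| * |P.U 1 t - tri (2 * π * (2 : ℕ) * t) / (2 * π * (2 : ℕ))| ≤
      8 * |(n : ℝ)| * ((2 * Real.exp (1 / 2) - 1) * (P.δ₀ / 2) / (2 * π * (2 : ℕ))) :=
    mul_le_mul_of_nonneg_left (by exact_mod_cast hU) (by positivity)
  refine h8.trans (le_of_eq ?_)
  push_cast
  field_simp
  ring

/-- The phase-1 rounding constant: `2π·(|n|(2e^{1/2}−1)δ₀/π) ≤ 2⁻²⁷·|n|` for `δ₀ ≤ 2⁻³⁰`. [folklore] -/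
theorem phaseOne_rounding_le {δ₀ : ℝ} (hδ₀ : 0 ≤ δ₀) (hδ₀' : δ₀ ≤ (2 : ℝ)⁻¹ ^ 30) (n : ℤ) :
    2 * π * (|(n : ℝ)| * ((2 * Real.exp (1 / 2) - 1) * δ₀ / π)) ≤ (2 : ℝ)⁻¹ ^ 27 * |(n : ℝ)| := by
  have hπ : (π : ℝ) ≠ 0 := Real.pi_pos.ne'
  have e : 2 * π * (|(n : ℝ)| * ((2 * Real.exp (1 / 2) - 1) * δ₀ / π)) = 2 * (2 * Real.exp (1 / 2) - 1) * δ₀ * |(n : ℝ)| := by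
    field_simp
  rw [e]
  have h1 : 2 * (2 * Real.exp (1 / 2) - 1) * δ₀ ≤ 8 * ((2 : ℝ)⁻¹ ^ 30) :=
    mul_le_mul two_mul_rounding_const_le hδ₀' hδ₀ (by norm_num)
  have h2 : (8 : ℝ) * ((2 : ℝ)⁻¹ ^ 30) = (2 : ℝ)⁻¹ ^ 27 := by norm_num
  rw [h2] at h1
  exact mul_le_mul_of_nonneg_right h1 (abs_nonneg _)

/-- **THE PHASE-0 PROFILE NEXT TO THE ONE-TOOTH SAWTOOTH**: `γ = 8`, `N₀ = 1`, `δ₀ > 0`, `d > 0`; with `ψ₀ = amp ⟨U 0, …⟩ γ`,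
for every `q` and real `t`: `|q·ψ₀(t) − 8q·tri(2πt)/(2π)| ≤ |q|·8(2e^{1/2}−1)δ₀/(2π)` (so `2π·η = 8|q|(2e^{1/2}−1)δ₀ ≤ 2⁻²⁵|q|`,
`…PhaseOneStartBox.rounding_slope_le`). [cite: Folland1999, Prop. 2.53] -/
theorem phaseZero_profile_near (hγ : P.γ = 8) (hN₀ : P.N₀ = 1) (hδ₀ : 0 < P.δ₀) (hd : 0 < P.d) (q : ℤ) (t : ℝ) :
    |q * amp ⟨P.U 0, P.U_periodic 0, P.contDiff_U (P.δ_pos hδ₀ hd 0)⟩ P.γ t -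
        ((8 * q : ℤ) : ℝ) * (tri (2 * π * t) / (2 * π))| ≤
      |(q : ℝ)| * (8 * ((2 * Real.exp (1 / 2) - 1) * P.δ₀ / (2 * π))) := by
  have hπ : 0 < π := Real.pi_pos
  have hN0 : P.N 0 = 1 := by simp [CascadeParams.N, hN₀]
  have hδ0 : P.δ 0 = P.δ₀ := by simp [CascadeParams.δ]
  have hU := abs_U_sub_exactProfile_le P hδ₀ hd (j := 0) (by rw [hN0]; norm_num) t
  rw [hN0, hδ0] at hU
  simp only [Nat.cast_one, mul_one] at hU
  rw [amp_apply, hγ]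
  have e : (q : ℝ) * (8 * P.U 0 t) - ((8 * q : ℤ) : ℝ) * (tri (2 * π * t) / (2 * π)) =
      8 * q * (P.U 0 t - tri (2 * π * t) / (2 * π)) := by push_cast; ring
  rw [e, abs_mul, abs_mul, abs_of_pos (by norm_num : (0:ℝ) < 8)]
  have h8 : 8 * |(q : ℝ)| * |P.U 0 t - tri (2 * π * t) / (2 * π)| ≤
      8 * |(q : ℝ)| * ((2 * Real.exp (1 / 2) - 1) * P.δ₀ / (2 * π)) :=
    mul_le_mul_of_nonneg_left hU (by positivity)
  refine h8.trans (le_of_eq ?_)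
  ring

end Cascade


/-! ## §2 The sharp one-tooth table for the rounded phase-0 chirps -/

/-- `1/π ≤ 0.31831` (`π > 3.141592`). [folklore] -/
theorem inv_pi_le_d5 : 1 / π ≤ (0.31831 : ℝ) := by
  have h := Real.pi_gt_d6
  rw [div_le_iff₀ Real.pi_pos]
  nlinarith

/-- **The rounded phase-0 chirp against the SHARP one-tooth table**: if `|ψ − 8·tri(2π·)/(2π)| ≤ η` and `q ≠ 0`, then for every `m`
`‖ĝ_q(m)‖ ≤ T(q,m) + 2π|q|η`, `T(q,m) = ½` if `m = ±8q`, `0` if `m` is even (`≠ ±8q`), `16|q|/(π|64q²−m²|)` if `m` is odd.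
[cite: Grafakos2014, Prop. 3.1.2 (5), Prop. 3.2.7 (3)] -/
theorem norm_fourierCoeff_twist_le_table (ψ : ShearProfile) {η : ℝ}
    (hη : ∀ t : ℝ, |ψ t - (8 : ℤ) * (tri (2 * π * t) / (2 * π))| ≤ η) {q : ℤ} (hq : q ≠ 0) (m : ℤ) :
    ‖fourierCoeff (twist ψ q) m‖ ≤
      (if 8 * q + m = 0 ∨ 8 * q - m = 0 then (1 / 2 : ℝ) else if m % 2 = 0 then 0
        else 16 * |(q : ℝ)| / (π * |64 * (q : ℝ) ^ 2 - (m : ℝ) ^ 2|)) + 2 * π * (|(q : ℝ)| * η) := by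
  have hπ : 0 < π := Real.pi_pos
  obtain ⟨g₀, hg₀c, hg₀⟩ := exists_exactChirp (8 * q)
  have hηq : ∀ t : ℝ, |q * ψ t - ((8 * q : ℤ) : ℝ) * (tri (2 * π * t) / (2 * π))| ≤ |(q : ℝ)| * η := by
    intro t
    have h := hη t
    rw [show (q : ℝ) * ψ t - ((8 * q : ℤ) : ℝ) * (tri (2 * π * t) / (2 * π)) =
      q * (ψ t - ((8 : ℤ) : ℝ) * (tri (2 * π * t) / (2 * π))) by push_cast; ring, abs_mul]
    exact mul_le_mul_of_nonneg_left h (abs_nonneg _)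
  have hround := norm_fourierCoeff_twist_le_of_near ψ q (8 * q) hg₀ hg₀c hηq m
  -- the exact chirp against the table
  have hlam : (8 * q : ℤ) ≠ 0 := by omega
  have htab : ‖fourierCoeff g₀ m‖ ≤ (if 8 * q + m = 0 ∨ 8 * q - m = 0 then (1 / 2 : ℝ) else if m % 2 = 0 then 0
        else 16 * |(q : ℝ)| / (π * |64 * (q : ℝ) ^ 2 - (m : ℝ) ^ 2|)) := by
    split_ifs with hlobe heven
    · rcases hlobe with h1 | h2
      · have hm : m = -(8 * q) := by omega
        rw [hm]; exact (norm_fourierCoeff_exactChirp_self_le hlam hg₀ hg₀c).1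
      · have hm : m = 8 * q := by omega
        rw [hm]; exact (norm_fourierCoeff_exactChirp_self_le hlam hg₀ hg₀c).2
    · rw [not_or] at hlobe
      have hev : Even (8 * q + m) := by
        rw [Int.even_iff]; omega
      rw [fourierCoeff_exactChirp_eq_zero_of_even hg₀ hg₀c hev (by omega) (by omega), norm_zero]
    · rw [not_or] at hlobe
      have h := norm_fourierCoeff_oneTooth_le_sharp (8 * q) hg₀ (m := m) hlobe.1 hlobe.2
      refine h.trans (le_of_eq ?_)
      push_cast
      rw [abs_mul, abs_of_pos (by norm_num : (0:ℝ) < 8)]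
      ring
  linarith

/-! ## §3 The amplitude bound for the phase-one iterate -/

/-- **SHARP TERMWISE AMPLITUDES OF `a₁`**: for `b = datum ∘ Φ_H(ψ)`, `a = b ∘ Φ_V(ψ)`, `|ψ − 8·tri(2π·)/(2π)| ≤ η` and `q ≠ 0`,
`‖𝓕a(n,q)‖ ≤ ½(W(q) + 2πη)·(T(q,n+1) + T(q,n−1) + 4π|q|η)` with the sharp tables `W(q) = T(±1,q)` (`½` at `q = ±8`, `0` at even `q`,
`16/(π|64−q²|)` at odd `q`) and `T(q,m)` of `norm_fourierCoeff_twist_le_table`. [cite: Grafakos2014, Prop. 3.1.2 (5), Prop. 3.2.7 (3)] -/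
theorem norm_mFourierCoeff_phaseOne_le_table (ψ : ShearProfile) {b a : UnitAddTorus (Fin 2) → ℝ}
    (hb : b = datum ∘ shearMap 0 1 ψ) (ha : a = b ∘ shearMap 1 0 ψ) {η : ℝ}
    (hη : ∀ t : ℝ, |ψ t - (8 : ℤ) * (tri (2 * π * t) / (2 * π))| ≤ η) (n : ℤ) {q : ℤ} (hq : q ≠ 0) :
    ‖mFourierCoeff (fun x => (a x : ℂ)) ![n, q]‖ ≤
      1 / 2 * ((if q = 8 ∨ q = -8 then (1 / 2 : ℝ) else if q % 2 = 0 then 0 else 16 / (π * |64 - (q : ℝ) ^ 2|)) + 2 * π * η) *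
        ((if 8 * q + (n + 1) = 0 ∨ 8 * q - (n + 1) = 0 then (1 / 2 : ℝ) else if (n + 1) % 2 = 0 then 0
            else 16 * |(q : ℝ)| / (π * |64 * (q : ℝ) ^ 2 - ((n + 1 : ℤ) : ℝ) ^ 2|)) +
          (if 8 * q + (n - 1) = 0 ∨ 8 * q - (n - 1) = 0 then (1 / 2 : ℝ) else if (n - 1) % 2 = 0 then 0
            else 16 * |(q : ℝ)| / (π * |64 * (q : ℝ) ^ 2 - ((n - 1 : ℤ) : ℝ) ^ 2|)) +
          4 * π * (|(q : ℝ)| * η)) := by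
  have hπ : 0 < π := Real.pi_pos
  have hη0 : 0 ≤ η := (abs_nonneg _).trans (hη 0)
  -- the mode formula
  have hform := mFourierCoeff_phaseOne ψ hb ![n, q]
  rw [← ha] at hform
  simp only [Matrix.cons_val_zero, Matrix.cons_val_one] at hform
  rw [hform]
  -- the four chirp coefficients against the tables
  have hq1 := norm_fourierCoeff_twist_le_table ψ hη hq (n + 1)
  have hq2 := norm_fourierCoeff_twist_le_table ψ hη hq (n - 1)
  have hp := norm_fourierCoeff_twist_le_table ψ hη one_ne_zero q
  have hm := norm_fourierCoeff_twist_le_table ψ hη (show (-1 : ℤ) ≠ 0 by norm_num) q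
  -- `T(±1, q) = W(q)`
  set W : ℝ := (if q = 8 ∨ q = -8 then (1 / 2 : ℝ) else if q % 2 = 0 then 0 else 16 / (π * |64 - (q : ℝ) ^ 2|)) with hW
  have hWp : (if 8 * (1 : ℤ) + q = 0 ∨ 8 * (1 : ℤ) - q = 0 then (1 / 2 : ℝ) else if q % 2 = 0 then 0
      else 16 * |((1 : ℤ) : ℝ)| / (π * |64 * ((1 : ℤ) : ℝ) ^ 2 - (q : ℝ) ^ 2|)) = W := by
    rw [hW]
    split_ifs <;> first | rfl | (exfalso; omega) | simp
  have hWm : (if 8 * (-1 : ℤ) + q = 0 ∨ 8 * (-1 : ℤ) - q = 0 then (1 / 2 : ℝ) else if q % 2 = 0 then 0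
      else 16 * |((-1 : ℤ) : ℝ)| / (π * |64 * ((-1 : ℤ) : ℝ) ^ 2 - (q : ℝ) ^ 2|)) = W := by
    rw [hW]
    split_ifs <;> first | rfl | (exfalso; omega) | simp
  rw [hWp, show |((1 : ℤ) : ℝ)| * η = η by simp] at hp
  rw [hWm, show |((-1 : ℤ) : ℝ)| * η = η by simp] at hm
  -- abbreviate the two fibre tables
  set T₁ : ℝ := (if 8 * q + (n + 1) = 0 ∨ 8 * q - (n + 1) = 0 then (1 / 2 : ℝ) else if (n + 1) % 2 = 0 then 0
    else 16 * |(q : ℝ)| / (π * |64 * (q : ℝ) ^ 2 - ((n + 1 : ℤ) : ℝ) ^ 2|)) with hT₁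
  set T₂ : ℝ := (if 8 * q + (n - 1) = 0 ∨ 8 * q - (n - 1) = 0 then (1 / 2 : ℝ) else if (n - 1) % 2 = 0 then 0
    else 16 * |(q : ℝ)| / (π * |64 * (q : ℝ) ^ 2 - ((n - 1 : ℤ) : ℝ) ^ 2|)) with hT₂
  have hW0 : 0 ≤ W := by rw [hW]; split_ifs <;> positivity
  have hT₁0 : 0 ≤ T₁ := by rw [hT₁]; split_ifs <;> positivity
  have hT₂0 : 0 ≤ T₂ := by rw [hT₂]; split_ifs <;> positivity
  have hqη : 0 ≤ 2 * π * (|(q : ℝ)| * η) := by positivity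
  -- the norm of the mode
  have hI : ‖(I / 2 : ℂ)‖ = 1 / 2 := by simp
  rw [norm_mul, hI]
  have h4 : ‖fourierCoeff (twist ψ q) (n + 1) * fourierCoeff (twist ψ (-1)) q -
      fourierCoeff (twist ψ q) (n - 1) * fourierCoeff (twist ψ 1) q‖ ≤
      (T₁ + 2 * π * (|(q : ℝ)| * η)) * (W + 2 * π * η) + (T₂ + 2 * π * (|(q : ℝ)| * η)) * (W + 2 * π * η) := by
    refine (norm_sub_le _ _).trans ?_
    rw [norm_mul, norm_mul]
    exact add_le_add (mul_le_mul hq1 hm (norm_nonneg _) (by positivity))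
      (mul_le_mul hq2 hp (norm_nonneg _) (by positivity))
  calc 1 / 2 * ‖fourierCoeff (twist ψ q) (n + 1) * fourierCoeff (twist ψ (-1)) q -
        fourierCoeff (twist ψ q) (n - 1) * fourierCoeff (twist ψ 1) q‖
      ≤ 1 / 2 * ((T₁ + 2 * π * (|(q : ℝ)| * η)) * (W + 2 * π * η) + (T₂ + 2 * π * (|(q : ℝ)| * η)) * (W + 2 * π * η)) :=
        mul_le_mul_of_nonneg_left h4 (by norm_num)
    _ = 1 / 2 * (W + 2 * π * η) * (T₁ + T₂ + 4 * π * (|(q : ℝ)| * η)) := by ring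

/-- **THE RATIONAL MAJORANT `Ā(n,q)`** (the table the generated per-fibre files evaluate): under `2πη ≤ 2⁻²⁵` and with `1/π ≤ 0.31831`,
`‖𝓕a(n,q)‖ ≤ ½(W̄(q) + 2⁻²⁵)(T̄(q,n+1) + T̄(q,n−1) + 2|q|·2⁻²⁵)` where `W̄`, `T̄` are `W`, `T` with `1/π` replaced by `0.31831`.
[cite: Grafakos2014, Prop. 3.1.2 (5), Prop. 3.2.7 (3)] -/
theorem norm_mFourierCoeff_phaseOne_le_rat (ψ : ShearProfile) {b a : UnitAddTorus (Fin 2) → ℝ}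
    (hb : b = datum ∘ shearMap 0 1 ψ) (ha : a = b ∘ shearMap 1 0 ψ) {η : ℝ}
    (hη : ∀ t : ℝ, |ψ t - (8 : ℤ) * (tri (2 * π * t) / (2 * π))| ≤ η) (hηs : 2 * π * η ≤ (2 : ℝ)⁻¹ ^ 25)
    (n : ℤ) {q : ℤ} (hq : q ≠ 0) :
    ‖mFourierCoeff (fun x => (a x : ℂ)) ![n, q]‖ ≤
      1 / 2 * ((if q = 8 ∨ q = -8 then (1 / 2 : ℝ) else if q % 2 = 0 then 0 else 16 * 0.31831 / |64 - (q : ℝ) ^ 2|) +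
          (2 : ℝ)⁻¹ ^ 25) *
        ((if 8 * q + (n + 1) = 0 ∨ 8 * q - (n + 1) = 0 then (1 / 2 : ℝ) else if (n + 1) % 2 = 0 then 0
            else 16 * |(q : ℝ)| * 0.31831 / |64 * (q : ℝ) ^ 2 - ((n + 1 : ℤ) : ℝ) ^ 2|) +
          (if 8 * q + (n - 1) = 0 ∨ 8 * q - (n - 1) = 0 then (1 / 2 : ℝ) else if (n - 1) % 2 = 0 then 0
            else 16 * |(q : ℝ)| * 0.31831 / |64 * (q : ℝ) ^ 2 - ((n - 1 : ℤ) : ℝ) ^ 2|) +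
          2 * |(q : ℝ)| * (2 : ℝ)⁻¹ ^ 25) := by
  have hπ : 0 < π := Real.pi_pos
  have hη0 : 0 ≤ η := (abs_nonneg _).trans (hη 0)
  have hϖ := inv_pi_le_d5
  have h := norm_mFourierCoeff_phaseOne_le_table ψ hb ha hη n hq
  refine h.trans ?_
  -- termwise comparisons of the tables
  have hdiv : ∀ {c d : ℝ}, 0 ≤ c → 0 < d → c / (π * d) ≤ c * 0.31831 / d := by
    intro c d hc hd
    rw [div_le_div_iff₀ (by positivity) hd]
    have : c * d ≤ c * 0.31831 * (π * d) := by
      have h1 : (1 : ℝ) ≤ 0.31831 * π := by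
        have := (div_le_iff₀ hπ).1 hϖ; linarith
      nlinarith [mul_nonneg hc hd.le]
    linarith
  have hWle : (if q = 8 ∨ q = -8 then (1 / 2 : ℝ) else if q % 2 = 0 then 0 else 16 / (π * |64 - (q : ℝ) ^ 2|)) ≤
      (if q = 8 ∨ q = -8 then (1 / 2 : ℝ) else if q % 2 = 0 then 0 else 16 * 0.31831 / |64 - (q : ℝ) ^ 2|) := by
    split_ifs with h1 h2
    · exact le_rfl
    · exact le_rfl
    · have hne : (64 : ℝ) - (q : ℝ) ^ 2 ≠ 0 := by
        have hq8 : q ≠ 8 ∧ q ≠ -8 := not_or.1 h1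
        have : (q : ℝ) ^ 2 ≠ 64 := by
          intro h
          have h' : ((q ^ 2 : ℤ) : ℝ) = ((64 : ℤ) : ℝ) := by push_cast; linarith
          have h'' : q ^ 2 = 64 := by exact_mod_cast h'
          have : (q - 8) * (q + 8) = 0 := by ring_nf; linarith
          rcases mul_eq_zero.1 this with h3 | h3 <;> omega
        intro h; exact this (by linarith)
      exact hdiv (by norm_num) (abs_pos.2 hne)
  have hTle : ∀ m : ℤ, (if 8 * q + m = 0 ∨ 8 * q - m = 0 then (1 / 2 : ℝ) else if m % 2 = 0 then 0
        else 16 * |(q : ℝ)| / (π * |64 * (q : ℝ) ^ 2 - (m : ℝ) ^ 2|)) ≤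
      (if 8 * q + m = 0 ∨ 8 * q - m = 0 then (1 / 2 : ℝ) else if m % 2 = 0 then 0
        else 16 * |(q : ℝ)| * 0.31831 / |64 * (q : ℝ) ^ 2 - (m : ℝ) ^ 2|) := by
    intro m
    split_ifs with h1 h2
    · exact le_rfl
    · exact le_rfl
    · have hne : 64 * (q : ℝ) ^ 2 - (m : ℝ) ^ 2 ≠ 0 := by
        have hq8 : 8 * q + m ≠ 0 ∧ 8 * q - m ≠ 0 := not_or.1 h1
        intro h
        have h' : (((8 * q + m) * (8 * q - m) : ℤ) : ℝ) = 0 := by push_cast; linarith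
        have h'' : (8 * q + m) * (8 * q - m) = 0 := by exact_mod_cast h'
        rcases mul_eq_zero.1 h'' with h3 | h3
        · exact hq8.1 h3
        · exact hq8.2 h3
      exact hdiv (by positivity) (abs_pos.2 hne)
  have hT1 := hTle (n + 1)
  have hT2 := hTle (n - 1)
  push_cast at hT1 hT2 ⊢
  have hqε : 4 * π * (|(q : ℝ)| * η) ≤ 2 * |(q : ℝ)| * (2 : ℝ)⁻¹ ^ 25 := by
    have := mul_le_mul_of_nonneg_left hηs (abs_nonneg (q : ℝ))
    nlinarith
  -- nonnegativity of the factors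
  have hA0 : 0 ≤ (if q = 8 ∨ q = -8 then (1 / 2 : ℝ) else if q % 2 = 0 then 0 else 16 / (π * |64 - (q : ℝ) ^ 2|)) + 2 * π * η := by
    have : 0 ≤ (if q = 8 ∨ q = -8 then (1 / 2 : ℝ) else if q % 2 = 0 then 0 else 16 / (π * |64 - (q : ℝ) ^ 2|)) := by
      split_ifs <;> positivity
    positivity
  have hB0 : ∀ m : ℤ, 0 ≤ (if 8 * q + m = 0 ∨ 8 * q - m = 0 then (1 / 2 : ℝ) else if m % 2 = 0 then 0
        else 16 * |(q : ℝ)| * 0.31831 / |64 * (q : ℝ) ^ 2 - (m : ℝ) ^ 2|) := by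
    intro m; split_ifs <;> positivity
  have hB1 := hB0 (n + 1)
  have hB2 := hB0 (n - 1)
  push_cast at hB1 hB2
  gcongr 1 / 2 * (?_) * ?_
  · exact add_le_add hWle hηs
  · linarith

/-! ## §4 The cascade instance -/

section Cascade

variable (P : CascadeParams)

/-- **`Ā(n,q)` FOR THE CASCADE'S PHASE-ONE ITERATE**: `γ = 8`, `N₀ = 1`, `0 < δ₀ ≤ 2⁻³⁰`, `d > 0`, `a 0 = datum`, `b 0 = a 0 ∘ Φ_H(ψ₀)`,
`a 1 = b 0 ∘ Φ_V(ψ₀)`: for `q ≠ 0`, `‖𝓕(a 1)(n,q)‖ ≤ Ā(n,q)` (the rational table of `norm_mFourierCoeff_phaseOne_le_rat`).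
[cite: Grafakos2014, Prop. 3.1.2 (5), Prop. 3.2.7 (3)] -/
theorem phaseOne_amplitude_le_rat (hγ : P.γ = 8) (hN₀ : P.N₀ = 1) (hδ₀ : 0 < P.δ₀) (hδ₀' : P.δ₀ ≤ (2 : ℝ)⁻¹ ^ 30) (hd : 0 < P.d)
    (a b : ℕ → UnitAddTorus (Fin 2) → ℝ) (h0 : a 0 = datum)
    (hb : b 0 = a 0 ∘ shearMap 0 1 (amp ⟨P.U 0, P.U_periodic 0, P.contDiff_U (P.δ_pos hδ₀ hd 0)⟩ P.γ))
    (hab : a 1 = b 0 ∘ shearMap 1 0 (amp ⟨P.U 0, P.U_periodic 0, P.contDiff_U (P.δ_pos hδ₀ hd 0)⟩ P.γ))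
    (n : ℤ) {q : ℤ} (hq : q ≠ 0) :
    ‖mFourierCoeff (fun x => (a 1 x : ℂ)) ![n, q]‖ ≤
      1 / 2 * ((if q = 8 ∨ q = -8 then (1 / 2 : ℝ) else if q % 2 = 0 then 0 else 16 * 0.31831 / |64 - (q : ℝ) ^ 2|) +
          (2 : ℝ)⁻¹ ^ 25) *
        ((if 8 * q + (n + 1) = 0 ∨ 8 * q - (n + 1) = 0 then (1 / 2 : ℝ) else if (n + 1) % 2 = 0 then 0
            else 16 * |(q : ℝ)| * 0.31831 / |64 * (q : ℝ) ^ 2 - ((n + 1 : ℤ) : ℝ) ^ 2|) +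
          (if 8 * q + (n - 1) = 0 ∨ 8 * q - (n - 1) = 0 then (1 / 2 : ℝ) else if (n - 1) % 2 = 0 then 0
            else 16 * |(q : ℝ)| * 0.31831 / |64 * (q : ℝ) ^ 2 - ((n - 1 : ℤ) : ℝ) ^ 2|) +
          2 * |(q : ℝ)| * (2 : ℝ)⁻¹ ^ 25) := by
  have hπ : 0 < π := Real.pi_pos
  set ψ : ShearProfile := amp ⟨P.U 0, P.U_periodic 0, P.contDiff_U (P.δ_pos hδ₀ hd 0)⟩ P.γ with hψ
  set η : ℝ := 8 * ((2 * Real.exp (1 / 2) - 1) * P.δ₀ / (2 * π)) with hηdef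
  have hη : ∀ t : ℝ, |ψ t - (8 : ℤ) * (tri (2 * π * t) / (2 * π))| ≤ η := by
    intro t
    have h := phaseZero_profile_near P hγ hN₀ hδ₀ hd 1 t
    simpa [hψ, hηdef] using h
  have hηs : 2 * π * η ≤ (2 : ℝ)⁻¹ ^ 25 := by
    have e : 2 * π * η = 8 * (2 * Real.exp (1 / 2) - 1) * P.δ₀ := by rw [hηdef]; field_simp
    rw [e]; exact rounding_slope_le hδ₀.le hδ₀'
  rw [h0] at hb
  exact norm_mFourierCoeff_phaseOne_le_rat ψ hb (by rw [hab]) hη hηs n hq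

end Cascade

end Summit.AnomalousDissipation.AnomalousDissipation.Theorems.SawtoothPulseCascade.K1Start
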